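import Summits.QuantumFields.YangMills.Theorems.LangevinControlUVOSLegsAtWeakCouplingCStubLocalityFlatApprox
import Literature.MathematicalPhysics.AQFT.OffDiagonalFlatDecay
import Literature.MathematicalPhysics.QuantumLattice.SchwingerGrowthTwoFactor
import HarnessLib

/-!
# Route `F4SubCurvatureDoor`, crux `SubCurvatureKernel` ⟨stmt-QuantumFields-23036⟩ — the REPRESENTATION CLAUSE VERBATIM (all off-diagonal test
# functions, supports touching the diagonal) for a kernel with the `‖u‖⁻⁸` bound

Helper file (`--supports stmt-QuantumFields-23036 --as helper`; free-hands seat `ym-line-frs-p2` g17, clause (K) of the soft-half scope).  KERNEL-GENERIC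
(no lattice input), definition-free, 0 sorry, standard axioms.  No item is closed; no summit, no crux and no mass gap is proved by this file.

WHAT.  Clause 6 of `SubCurvatureKernel` (route file :338ff) wants `S₁ 2 F = ∫ K(x₀ − x₁) F(x) dx` (with integrability) for EVERY off-diagonal test
function — Schwartz functions vanishing with all derivatives on the coincidence locus `x₀ = x₁`, whose supports may touch it.  ✓`exists_gluedKernel_of_offDiagLimitAlong`
delivers a kernel with the bound `‖K u‖ ≤ A (1 + ‖u‖⁻¹)⁸` representing `S₂` on compactly supported test functions supported AWAY from the diagonal.  This file
closes the gap, kernel-generically: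

* `norm_kernel_mul_le` — for off-diagonal `G` and such a `K`: `‖K(x₀ − x₁) G(x)‖ ≤ 2⁸ 4⁹ A |G|₉ (1 + ‖x‖)⁻⁹` — the `‖u‖⁻⁸` singularity is absorbed
  by the order-8 flat vanishing of `G` at the diagonal (tree ✓`IsOffDiagonal.one_add_norm_pow_mul_norm_le_sub`, which also carries the Schwartz
  decay; `|G|₉` = ✓`schwartzNorm 9`);
* ★ `repr_of_isOffDiagonal` — if `K` is measurable with that bound and represents a continuous `S₂` on compactly supported test functions supported in
  every `Separated 2 δ`, then `S₂ F = ∫ K(x₀ − x₁) F` with integrability for EVERY off-diagonal `F` (separated compactly supported approximants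
  ✓`exists_separated_tendsto_of_isOffDiagonal` converge in `𝓢`, hence pointwise and with bounded `|·|₉`; dominated convergence with the dominating
  function `(1 + ‖x‖)⁻⁹ ∈ L¹((ℝ⁴)²)`; continuity of `S₂`).

HONEST LABEL: clause (K) of the SOFT half of ⟨23036⟩ in the letter of clause 6 for a MEASURABLE (not yet continuous) complex kernel; (C) continuity,
realness and the SUB-CURVATURE clause remain OPEN; ⟨23036⟩ is an open problem; the Yang–Mills mass gap is NOT proved; no summit is proved by a line.
-/

set_option autoImplicit false

noncomputable section

open scoped SchwartzMap BigOperators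
open MeasureTheory Filter Topology Set
open Literature.MathematicalPhysics.AQFT (IsOffDiagonal coincidenceLocus mem_coincidenceLocus)
open Literature.MathematicalPhysics.QuantumLattice (schwartzNorm schwartzNorm_nonneg norm_le_schwartzNorm continuous_schwartzNorm)
open Summit.QuantumFields.YangMills.Cruxes.OSLegsAtWeakCouplingC.Sketch (Separated exists_separated_tendsto_of_isOffDiagonal)

namespace Summit.QuantumFields.YangMills.Theorems.F4SubCurvatureDoorSubCurvatureKernelRepr

/-- Test functions supported in `Separated 2 δ`, `δ > 0`, are off-diagonal. [bookkeeping] -/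
theorem isOffDiagonal_of_separated {δ : ℝ} (hδ : 0 < δ) (G : 𝓢((Fin 2 → EuclideanSpace ℝ (Fin 4)), ℂ))
    (hG : tsupport (G : _ → ℂ) ⊆ Separated 2 δ) : IsOffDiagonal G := by
  refine IsOffDiagonal.of_tsupport_subset fun y hy hcoin => ?_
  obtain ⟨i, j, hij, hyij⟩ := (mem_coincidenceLocus y).1 hcoin
  have h : δ ≤ dist (y i) (y j) := hG hy i j hij
  rw [hyij, dist_self] at h
  exact absurd h (not_le.2 hδ)

/-- **The `‖u‖⁻⁸` singularity against order-8 flatness.**  For an off-diagonal test function `G` and a kernel with `‖K u‖ ≤ A (1 + ‖u‖⁻¹)⁸`: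
`‖K(x₀ − x₁) G(x)‖ ≤ 2⁸ 4⁹ A |G|₉ (1 + ‖x‖)⁻⁹`. [folklore] -/
theorem norm_kernel_mul_le (K : EuclideanSpace ℝ (Fin 4) → ℂ) {A : ℝ} (hA : 0 ≤ A)
    (hKb : ∀ u, ‖K u‖ ≤ A * (1 + ‖u‖⁻¹) ^ 8) (G : 𝓢((Fin 2 → EuclideanSpace ℝ (Fin 4)), ℂ)) (hG : IsOffDiagonal G)
    (x : Fin 2 → EuclideanSpace ℝ (Fin 4)) :
    ‖K (x 0 - x 1) * G x‖ ≤ 2 ^ 8 * 4 ^ 9 * A * schwartzNorm 9 G * ((1 + ‖x‖) ^ 9)⁻¹ := by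
  have hS0 : 0 ≤ schwartzNorm 9 G := schwartzNorm_nonneg 9 G
  have hx1 : 0 < (1 + ‖x‖) ^ 9 := by positivity
  set r : ℝ := ‖x 0 - x 1‖ with hr
  have hr0 : 0 ≤ r := norm_nonneg _
  rw [norm_mul]
  by_cases hx01 : x 0 = x 1
  · -- on the diagonal `G` vanishes
    have hG0 : G x = 0 := hG.apply_eq_zero ((mem_coincidenceLocus x).2 ⟨0, 1, by decide, hx01⟩)
    rw [hG0, norm_zero, mul_zero]
    positivity
  have hrpos : 0 < r := norm_pos_iff.2 (sub_ne_zero.2 hx01)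
  -- Schwartz decay of `G` (order 9) in both regimes
  have hdecay : (1 + ‖x‖) ^ 9 * ‖G x‖ ≤ 2 ^ 9 * schwartzNorm 9 G := by
    have h := SchwartzMap.one_add_le_sup_seminorm_apply (𝕜 := ℂ) (m := (9, 0)) le_rfl le_rfl G x
    rw [norm_iteratedFDeriv_zero] at h
    exact h.trans (mul_le_mul_of_nonneg_left
      (Literature.MathematicalPhysics.AQFT.sup_seminorm_le_schwartzNorm le_rfl (Nat.zero_le 9) G) (by positivity))
  rcases le_or_gt r 1 with hr1 | hr1
  · -- near the diagonal: flatness of order 8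
    have hflat : (1 + ‖x‖) ^ 9 * ‖G x‖ ≤ 4 ^ 9 * schwartzNorm 9 G * r ^ 8 / (7 : ℕ).factorial := by
      have h := hG.one_add_norm_pow_mul_norm_le_sub (a := (1 : Fin 2)) (b := 0) (by decide) (y := x)
        (by rw [← hr]; exact hr1) (k := 9) (M := 7) (m := 9) le_rfl (by norm_num)
      simpa [← hr] using h
    have hflat' : ‖G x‖ ≤ 4 ^ 9 * schwartzNorm 9 G * r ^ 8 * ((1 + ‖x‖) ^ 9)⁻¹ := by
      rw [← div_eq_mul_inv, le_div_iff₀ hx1, mul_comm]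
      refine hflat.trans (div_le_self (by positivity) ?_)
      exact_mod_cast Nat.one_le_iff_ne_zero.2 (Nat.factorial_ne_zero 7)
    have hKr : ‖K (x 0 - x 1)‖ ≤ A * 2 ^ 8 * (r ^ 8)⁻¹ := by
      have h1 : 1 + r⁻¹ ≤ 2 * r⁻¹ := by
        have : 1 ≤ r⁻¹ := one_le_inv_iff₀.2 ⟨hrpos, hr1⟩
        linarith
      calc ‖K (x 0 - x 1)‖ ≤ A * (1 + r⁻¹) ^ 8 := hKb _
        _ ≤ A * (2 * r⁻¹) ^ 8 := by gcongr
        _ = A * 2 ^ 8 * (r ^ 8)⁻¹ := by rw [mul_pow, inv_pow]; ring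
    calc ‖K (x 0 - x 1)‖ * ‖G x‖
        ≤ (A * 2 ^ 8 * (r ^ 8)⁻¹) * (4 ^ 9 * schwartzNorm 9 G * r ^ 8 * ((1 + ‖x‖) ^ 9)⁻¹) :=
          mul_le_mul hKr hflat' (norm_nonneg _) (by positivity)
      _ = 2 ^ 8 * 4 ^ 9 * A * schwartzNorm 9 G * ((1 + ‖x‖) ^ 9)⁻¹ * ((r ^ 8)⁻¹ * r ^ 8) := by ring
      _ = 2 ^ 8 * 4 ^ 9 * A * schwartzNorm 9 G * ((1 + ‖x‖) ^ 9)⁻¹ := by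
          rw [inv_mul_cancel₀ (pow_ne_zero 8 hrpos.ne'), mul_one]
  · -- away from the diagonal: the kernel is bounded by `2⁸ A`
    have hKr : ‖K (x 0 - x 1)‖ ≤ A * 2 ^ 8 := by
      have h1 : 1 + r⁻¹ ≤ 2 := by
        have : r⁻¹ ≤ 1 := inv_le_one_of_one_le₀ hr1.le
        linarith
      calc ‖K (x 0 - x 1)‖ ≤ A * (1 + r⁻¹) ^ 8 := hKb _
        _ ≤ A * 2 ^ 8 := by gcongr
    have hG' : ‖G x‖ ≤ 4 ^ 9 * schwartzNorm 9 G * ((1 + ‖x‖) ^ 9)⁻¹ := by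
      rw [← div_eq_mul_inv, le_div_iff₀ hx1, mul_comm]
      refine hdecay.trans ?_
      have : (2 : ℝ) ^ 9 ≤ 4 ^ 9 := by norm_num
      exact mul_le_mul_of_nonneg_right this hS0
    calc ‖K (x 0 - x 1)‖ * ‖G x‖ ≤ (A * 2 ^ 8) * (4 ^ 9 * schwartzNorm 9 G * ((1 + ‖x‖) ^ 9)⁻¹) :=
          mul_le_mul hKr hG' (norm_nonneg _) (by positivity)
      _ = 2 ^ 8 * 4 ^ 9 * A * schwartzNorm 9 G * ((1 + ‖x‖) ^ 9)⁻¹ := by ring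

/-- `(1 + ‖x‖)⁻⁹` is integrable on `(ℝ⁴)²` (dimension `8 < 9`). [folklore] -/
theorem integrable_inv_one_add_norm_pow_nine :
    Integrable (fun x : Fin 2 → EuclideanSpace ℝ (Fin 4) => ((1 + ‖x‖) ^ 9)⁻¹) := by
  have h8 : (Module.finrank ℝ (Fin 2 → EuclideanSpace ℝ (Fin 4)) : ℝ) < 9 := by
    rw [Module.finrank_pi_fintype]
    simp only [finrank_euclideanSpace, Fintype.card_fin, Finset.sum_const, Finset.card_univ, smul_eq_mul]
    norm_num
  refine (integrable_one_add_norm (μ := volume) h8).congr (Eventually.of_forall fun x => ?_)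
  have hpos : 0 < 1 + ‖x‖ := by positivity
  beta_reduce
  rw [show (-9 : ℝ) = -(9 : ℕ) by norm_num, Real.rpow_neg hpos.le, Real.rpow_natCast]

/-- ★ **THE REPRESENTATION CLAUSE VERBATIM.**  A measurable kernel with `‖K u‖ ≤ A (1 + ‖u‖⁻¹)⁸` which represents a continuous linear functional `S₂` on
`𝓢((ℝ⁴)², ℂ)` on compactly supported test functions supported in every `Separated 2 δ` (`δ > 0`) represents it on EVERY off-diagonal test function:
`K(x₀ − x₁) F(x)` is integrable and `S₂ F = ∫ K(x₀ − x₁) F(x) dx`. [folklore] -/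
theorem repr_of_isOffDiagonal (S₂ : 𝓢((Fin 2 → EuclideanSpace ℝ (Fin 4)), ℂ) →L[ℂ] ℂ) (K : EuclideanSpace ℝ (Fin 4) → ℂ)
    (hKm : Measurable K) {A : ℝ} (hA : 0 ≤ A) (hKb : ∀ u, ‖K u‖ ≤ A * (1 + ‖u‖⁻¹) ^ 8)
    (hrep : ∀ δ : ℝ, 0 < δ → ∀ F : 𝓢((Fin 2 → EuclideanSpace ℝ (Fin 4)), ℂ), HasCompactSupport (F : _ → ℂ) →
      tsupport (F : _ → ℂ) ⊆ Separated 2 δ →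
        Integrable (fun x : Fin 2 → EuclideanSpace ℝ (Fin 4) => K (x 0 - x 1) * F x) ∧
          S₂ F = ∫ x : Fin 2 → EuclideanSpace ℝ (Fin 4), K (x 0 - x 1) * F x)
    (F : 𝓢((Fin 2 → EuclideanSpace ℝ (Fin 4)), ℂ)) (hF : IsOffDiagonal F) :
    Integrable (fun x : Fin 2 → EuclideanSpace ℝ (Fin 4) => K (x 0 - x 1) * F x) ∧
      S₂ F = ∫ x : Fin 2 → EuclideanSpace ℝ (Fin 4), K (x 0 - x 1) * F x := by
  -- measurability of the integrands
  have hsubm : Measurable fun x : Fin 2 → EuclideanSpace ℝ (Fin 4) => x 0 - x 1 :=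
    (measurable_pi_apply 0).sub (measurable_pi_apply 1)
  have hmeas : ∀ G : 𝓢((Fin 2 → EuclideanSpace ℝ (Fin 4)), ℂ),
      AEStronglyMeasurable (fun x : Fin 2 → EuclideanSpace ℝ (Fin 4) => K (x 0 - x 1) * G x) volume := fun G =>
    ((hKm.comp hsubm).mul G.continuous.measurable).aestronglyMeasurable
  -- the dominating function
  set C : ℝ := 2 ^ 8 * 4 ^ 9 * A with hC
  have hC0 : 0 ≤ C := by positivity
  have hbnd : ∀ G : 𝓢((Fin 2 → EuclideanSpace ℝ (Fin 4)), ℂ), IsOffDiagonal G →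
      ∀ x, ‖K (x 0 - x 1) * G x‖ ≤ C * schwartzNorm 9 G * ((1 + ‖x‖) ^ 9)⁻¹ := fun G hG x => by
    have h := norm_kernel_mul_le K hA hKb G hG x
    simpa only [hC] using h
  -- integrability of `K F`
  have hint : Integrable (fun x : Fin 2 → EuclideanSpace ℝ (Fin 4) => K (x 0 - x 1) * F x) :=
    Integrable.mono' ((integrable_inv_one_add_norm_pow_nine).const_mul (C * schwartzNorm 9 F)) (hmeas F)
      (Eventually.of_forall (hbnd F hF))
  refine ⟨hint, ?_⟩
  -- separated compactly supported approximants
  obtain ⟨u, hu_c, hu_sep, hu_lim⟩ := exists_separated_tendsto_of_isOffDiagonal F hF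
  have hu_off : ∀ m, IsOffDiagonal (u m) := fun m => by
    obtain ⟨δ, hδ, hsep⟩ := hu_sep m
    exact isOffDiagonal_of_separated hδ (u m) hsep
  have hu_rep : ∀ m, S₂ (u m) = ∫ x : Fin 2 → EuclideanSpace ℝ (Fin 4), K (x 0 - x 1) * (u m) x := fun m => by
    obtain ⟨δ, hδ, hsep⟩ := hu_sep m
    exact (hrep δ hδ (u m) (hu_c m) hsep).2
  -- `S₂ (u m) → S₂ F`
  have hS : Tendsto (fun m => S₂ (u m)) atTop (𝓝 (S₂ F)) := (S₂.continuous.tendsto F).comp hu_lim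
  -- Schwartz norms along the sequence are bounded, values converge pointwise
  have hqN : ∀ N : ℕ, Tendsto (fun m => schwartzNorm N (u m)) atTop (𝓝 (schwartzNorm N F)) := fun N =>
    ((continuous_schwartzNorm (X := Fin 2 → EuclideanSpace ℝ (Fin 4)) N).tendsto F).comp hu_lim
  have hq : Tendsto (fun m => schwartzNorm 9 (u m)) atTop (𝓝 (schwartzNorm 9 F)) := hqN 9
  have hq_ev : ∀ᶠ m in atTop, schwartzNorm 9 (u m) ≤ schwartzNorm 9 F + 1 :=
    (hq.eventually (eventually_le_nhds (lt_add_one _))).mono fun m hm => hm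
  have hpt : ∀ x, Tendsto (fun m => (u m) x) atTop (𝓝 (F x)) := by
    intro x
    have hdiffN : ∀ N : ℕ, Tendsto (fun m => schwartzNorm N (u m - F)) atTop
        (𝓝 (schwartzNorm N ((0 : 𝓢((Fin 2 → EuclideanSpace ℝ (Fin 4)), ℂ))))) := fun N => by
      have h1 : Tendsto (fun m => u m - F) atTop (𝓝 (F - F)) := hu_lim.sub tendsto_const_nhds
      rw [sub_self] at h1
      exact ((continuous_schwartzNorm (X := Fin 2 → EuclideanSpace ℝ (Fin 4)) N).tendsto _).comp h1
    have h0 : Tendsto (fun m => schwartzNorm 0 (u m - F)) atTop (𝓝 0) := by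
      have h2 := hdiffN 0
      have h3 : schwartzNorm 0 (0 : 𝓢((Fin 2 → EuclideanSpace ℝ (Fin 4)), ℂ)) = 0 := map_zero _
      rwa [h3] at h2
    rw [tendsto_iff_norm_sub_tendsto_zero]
    refine squeeze_zero (fun m => norm_nonneg _) (fun m => ?_) h0
    have h := norm_le_schwartzNorm 0 (u m - F) x
    rwa [sub_apply] at h
  -- dominated convergence
  have hlim : Tendsto (fun m => ∫ x : Fin 2 → EuclideanSpace ℝ (Fin 4), K (x 0 - x 1) * (u m) x) atTop
      (𝓝 (∫ x : Fin 2 → EuclideanSpace ℝ (Fin 4), K (x 0 - x 1) * F x)) := by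
    refine tendsto_integral_filter_of_dominated_convergence
      (fun x => C * (schwartzNorm 9 F + 1) * ((1 + ‖x‖) ^ 9)⁻¹)
      (Eventually.of_forall fun m => hmeas (u m)) ?_
      ((integrable_inv_one_add_norm_pow_nine).const_mul _) (Eventually.of_forall fun x => (hpt x).const_mul _)
    refine hq_ev.mono fun m hm => Eventually.of_forall fun x => ?_
    calc ‖K (x 0 - x 1) * (u m) x‖ ≤ C * schwartzNorm 9 (u m) * ((1 + ‖x‖) ^ 9)⁻¹ := hbnd (u m) (hu_off m) x
      _ ≤ C * (schwartzNorm 9 F + 1) * ((1 + ‖x‖) ^ 9)⁻¹ := by gcongr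
  have hS' : Tendsto (fun m => S₂ (u m)) atTop (𝓝 (∫ x : Fin 2 → EuclideanSpace ℝ (Fin 4), K (x 0 - x 1) * F x)) := by
    refine hlim.congr fun m => ?_
    exact (hu_rep m).symm
  exact tendsto_nhds_unique hS hS'

end Summit.QuantumFields.YangMills.Theorems.F4SubCurvatureDoorSubCurvatureKernelRepr

end
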